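import Summits.CriticalPhenomena.PercolationContinuityZ3.Theorems.Transplant.SkelFrmBChoiceResidC
import Summits.CriticalPhenomena.PercolationContinuityZ3.Theorems.Transplant.SkelFrmBParamsFaceFloorsZPiYA
import HarnessLib

/-!
# N2 (frames-only node `SamePDropOfSkeletonFrm₁`, OPEN) — (ζ″) ledger: THE (F)-COLUMN RESIDUAL SLOT FUNCTIONS `NegB.gxFc / fxFc / exFc` AND THEIR FLOOR LEMMAS
# (lead g12 2026-08-23T08:31:58Z: "each column posts its residual FUNCTION + floor list, the node tuple takes the union"; the (F) twin of stmt-g21's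
# `SkelFrmBChoiceResidC` p359507, same style; hp-8 g42 POSTED FLOORS (1)–(7) 09:33:53Z + the assemblies' extra rows 10:25:42Z)

The floors the (F) value layer (`SkelFrmBParamsFace…`, assemblies `KS.floorsX2_XFs` / `KS.floorsY2_YFs`) puts on the residual slots, as SLOT FUNCTIONS of the
p-fixed data:
* box residual **`gxFc mk c : Neg.FSlot := max {22000·Kq·(KS0.R'0 mk + 2), 64·S_F c mk}`** — J19 `hR0/hMR0/hℓA` (the first term is also in `gxC`; repeated so the
  (F) column's requirement is self-contained) and the face frames' `hS64 : 64·S_F ≤ M_L` ⊇ `hS : 16·S_F ≤ M_L` (`S_F := KS.SF c mk`, BridgeF);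
* width residual **`fxFc mk : Neg.FSlot := 2400·Kq·(KS0.R'0 mk + 2)`** — the along floors' `hnA24` (FaceFloorsAYA-N2, raised from N1's 2000 by the creep-aware
  tangential range 240·Kq+10) ⊇ `hnA` (2000) ⊇ `hRn0`;
* excess residual **`exFc mk c : GSlot := max {KS.πBudX c mk g f, KS.πBudY c mk g f}`** — the two REACH BUDGETS of FaceFloorsPiXA/ZPiYA-N2 (N1 read the slot
  `exA` inside the value files; N2 names the budgets and takes `hr : πBud ≤ r`, served as `πBud ≤ ex ≤ r`).
* transfer to any dominating slot value (the node file's `gxQ/fxQ/exQ ⊒ gxFc/fxFc/exFc`): **`hR0F_of_ge`** (`22000·Kq·(R'0+2) ≤ M_L (KS.gT mk gx)` and the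
  `22000·(R'0+2)` form), **`hS64_of_ge`**, **`hS_of_ge`**, **`hℓAF_of_ge`** (needs `EqNumL`), **`hnA24_of_ge`**, **`hnAF_of_ge`**, **`hRn0F_of_ge`**,
  **`hπX_of_ge`**, **`hπY_of_ge`**.
The cell-unit rows (4) `6·R'0+11 ≤ u₀A`, `14·R'0+27 ≤ u₁A`, `2 ≤ u₁A` are NOT slot functions of this file: they follow from the box floor by p1-g18's
`NegB.uA_oth_factsR0` / `ML_floorR0_of_Kq` (FaceBandAR0 p361234) and `KS.ℓL_le_u₁A` (FaceFloorsLAdYA), discharged in the HA files.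
CELL-AGNOSTIC; imports ResidC (style + `RLD`), ZPiYA (budgets; ⟹ PiXA, BridgeFrameF, SlotsT).
NON-VACUITY: definitions + `le_max`-level lemmas.
builds on p205010 (kernel theorem, internal audit signed; external expert review pending) — nothing in this file uses p205010; NOTHING is claimed about the open
node `SamePDropOfSkeletonFrm₁`.
Lane `prim-bschramm`, seat `prim-hp-8` (gen 42); helper file (`--supports stmt-CriticalPhenomena-4575 --as helper`).
[cite: KozmaNitzan2024, §4 Theorem 6 (pp. 25–31): the order of constants] [cite: MartineauTassion2017, §3.2 Lemma 3.5]
-/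

noncomputable section

open scoped Classical

namespace Summit.CriticalPhenomena.PercolationContinuityZ3.Theorems.Transplant

namespace PlanarSkeletonFrm

namespace NegB

open Literature.Probability.Percolation Literature.Probability.LatticeModels SimpleGraph
open SkelConc (Consts)
open Skelφ.StepI (DataNS OutNS)
open Neg

/-! ## §1 The (F)-column residual slot functions -/

/-- **The (F)-column BOX residual** `gxFc mk c := max {22000·Kq·(R′0+2), 64·S_F c mk}`. [this work] -/
def gxFc (mk c : ℕ) : Neg.FSlot := fun κ _ _ _ _ _ Φ t p D =>
  max (22000 * Neg.Kq κ * (KS0.R'0 κ Φ t p D mk + 2)) (64 * KS.SF κ Φ t p D c mk)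

/-- **The (F)-column WIDTH residual** `fxFc mk := 2400·Kq·(R′0+2)`. [this work] -/
def fxFc (mk : ℕ) : Neg.FSlot := fun κ _ _ _ _ _ Φ t p D => 2400 * Neg.Kq κ * (KS0.R'0 κ Φ t p D mk + 2)

/-- **The (F)-column EXCESS residual** `exFc mk c := max {πBudX c mk g f, πBudY c mk g f}`. [this work] -/
def exFc (mk c : ℕ) : GSlot := fun κ _ _ _ _ _ Φ t p D g f => max (KS.πBudX κ Φ t p D c mk g f) (KS.πBudY κ Φ t p D c mk g f)

section Floors

variable (κ : Consts) {V : Type} [DecidableEq V] [Countable V] {G : SimpleGraph V} [G.LocallyFinite] (Φ : PlanarSkeletonFrm G) (t : V) (p : unitInterval)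
  (D : DataNS V) (g f mk c : ℕ)

/-- `gxFc` by name. [folklore] -/
theorem gxFc_at : gxFc mk c κ Φ t p D = max (22000 * Neg.Kq κ * (KS0.R'0 κ Φ t p D mk + 2)) (64 * KS.SF κ Φ t p D c mk) := rfl

/-- `fxFc` by name. [folklore] -/
theorem fxFc_at : fxFc mk κ Φ t p D = 2400 * Neg.Kq κ * (KS0.R'0 κ Φ t p D mk + 2) := rfl

/-- `exFc` by name. [folklore] -/
theorem exFc_at : exFc mk c κ Φ t p D g f = max (KS.πBudX κ Φ t p D c mk g f) (KS.πBudY κ Φ t p D c mk g f) := rfl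

/-- **The two box floors inside `gxFc`.** [folklore] -/
theorem gxFc_floors : 22000 * Neg.Kq κ * (KS0.R'0 κ Φ t p D mk + 2) ≤ gxFc mk c κ Φ t p D ∧ 64 * KS.SF κ Φ t p D c mk ≤ gxFc mk c κ Φ t p D := by
  refine ⟨?_, ?_⟩ <;> rw [gxFc_at] <;> omega

/-- **The two reach budgets inside `exFc`.** [folklore] -/
theorem exFc_floors : KS.πBudX κ Φ t p D c mk g f ≤ exFc mk c κ Φ t p D g f ∧ KS.πBudY κ Φ t p D c mk g f ≤ exFc mk c κ Φ t p D g f := by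
  refine ⟨?_, ?_⟩ <;> rw [exFc_at] <;> omega

/-- The width floor inside `fxFc` (equality). [folklore] -/
theorem fxFc_floor : 2400 * Neg.Kq κ * (KS0.R'0 κ Φ t p D mk + 2) ≤ fxFc mk κ Φ t p D := le_of_eq (fxFc_at κ Φ t p D mk).symm

end Floors

/-! ## §2 Transfer to any dominating slot value (the node file's `gxQ/fxQ/exQ ⊒ gxFc/fxFc/exFc`) -/

section Transfer

variable {κ : Consts} {V : Type} [DecidableEq V] [Countable V] {G : SimpleGraph V} [G.LocallyFinite] {Φ : PlanarSkeletonFrm G} {t : V} {p : unitInterval}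
  {mk c : ℕ}

/-- **J19 box floors at `g := KS.gT mk gx`** from any box residual dominating `gxFc`: `22000·Kq·(R′0+2) ≤ M_L` and the Kq-free `22000·(R′0+2) ≤ M_L`
(the HA files' `hMR0`/`hR0`). [folklore] -/
theorem hR0F_of_ge {gx : Neg.FSlot} (h : ∀ D : DataNS V, gxFc mk c κ Φ t p D ≤ gx κ Φ t p D) (D : DataNS V) :
    22000 * Neg.Kq κ * (KS0.R'0 κ Φ t p D mk + 2) ≤ ML κ Φ t p D (KS.gT mk gx κ Φ t p D) ∧
      22000 * (KS0.R'0 κ Φ t p D mk + 2) ≤ ML κ Φ t p D (KS.gT mk gx κ Φ t p D) := by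
  have h1 := (gxFc_floors κ Φ t p D mk c).1.trans ((h D).trans ((KS.gT_floors κ Φ t p D mk gx).2.2.2.trans (ML_le_ML κ Φ t p D _).2))
  have hKq := Neg.one_le_Kq κ
  refine ⟨h1, le_trans ?_ h1⟩
  calc 22000 * (KS0.R'0 κ Φ t p D mk + 2) = 22000 * 1 * (KS0.R'0 κ Φ t p D mk + 2) := by ring
    _ ≤ 22000 * Neg.Kq κ * (KS0.R'0 κ Φ t p D mk + 2) := by gcongr

/-- **`hS64 : 64·S_F ≤ M_L (KS.gT mk gx)`** from any box residual dominating `gxFc`. [folklore] -/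
theorem hS64_of_ge {gx : Neg.FSlot} (h : ∀ D : DataNS V, gxFc mk c κ Φ t p D ≤ gx κ Φ t p D) (D : DataNS V) :
    64 * KS.SF κ Φ t p D c mk ≤ ML κ Φ t p D (KS.gT mk gx κ Φ t p D) :=
  (gxFc_floors κ Φ t p D mk c).2.trans ((h D).trans ((KS.gT_floors κ Φ t p D mk gx).2.2.2.trans (ML_le_ML κ Φ t p D _).2))

/-- **`hS : 16·S_F ≤ M_L (KS.gT mk gx)`** (from `hS64`). [folklore] -/
theorem hS_of_ge {gx : Neg.FSlot} (h : ∀ D : DataNS V, gxFc mk c κ Φ t p D ≤ gx κ Φ t p D) (D : DataNS V) :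
    16 * KS.SF κ Φ t p D c mk ≤ ML κ Φ t p D (KS.gT mk gx κ Φ t p D) :=
  le_trans (by omega) (hS64_of_ge h D)

/-- **J19 `hℓA`**: `22000·Kq·(R′0+2) ≤ ℓ_L` at `KS.gT mk gx`, under the numeric long clause (`M_L + 1 ≤ ℓ_L`). [folklore] -/
theorem hℓAF_of_ge {gx : Neg.FSlot} (h : ∀ D : DataNS V, gxFc mk c κ Φ t p D ≤ gx κ Φ t p D) (D : DataNS V) {f : ℕ}
    (hN : EqNumL κ Φ t p D (KS.gT mk gx κ Φ t p D) f) : 22000 * Neg.Kq κ * (KS0.R'0 κ Φ t p D mk + 2) ≤ ℓL κ Φ t p D (KS.gT mk gx κ Φ t p D) f := by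
  have h1 := (hR0F_of_ge h D).1
  have h2 := hN.ℓ_le
  have h1' : ((22000 * Neg.Kq κ * (KS0.R'0 κ Φ t p D mk + 2) : ℕ) : ℤ) ≤ (ML κ Φ t p D (KS.gT mk gx κ Φ t p D) : ℤ) := by exact_mod_cast h1
  have : ((22000 * Neg.Kq κ * (KS0.R'0 κ Φ t p D mk + 2) : ℕ) : ℤ) ≤ (ℓL κ Φ t p D (KS.gT mk gx κ Φ t p D) f : ℕ) := by linarith
  exact_mod_cast this

/-- **`hnA24`**: `2400·Kq·(R′0+2) ≤ n_L g (KS.fT mk fx)` from any width residual dominating `fxFc` (EqNumL-free, any box value `g`). [folklore] -/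
theorem hnA24_of_ge {fx : Neg.FSlot} (h : ∀ D : DataNS V, fxFc mk κ Φ t p D ≤ fx κ Φ t p D) (D : DataNS V) (g : ℕ) :
    2400 * Neg.Kq κ * (KS0.R'0 κ Φ t p D mk + 2) ≤ nL κ Φ t p D g (KS.fT mk fx κ Φ t p D) :=
  (fxFc_floor κ Φ t p D mk).trans ((h D).trans (((KS.fT_floors κ Φ t p D mk fx).2.2.2).trans (n₁L_le_nL κ Φ t p D g _).2))

/-- **`hnA`**: `2000·Kq·(R′0+2) ≤ n_L g (KS.fT mk fx)` (from `hnA24`). [folklore] -/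
theorem hnAF_of_ge {fx : Neg.FSlot} (h : ∀ D : DataNS V, fxFc mk κ Φ t p D ≤ fx κ Φ t p D) (D : DataNS V) (g : ℕ) :
    2000 * Neg.Kq κ * (KS0.R'0 κ Φ t p D mk + 2) ≤ nL κ Φ t p D g (KS.fT mk fx κ Φ t p D) :=
  le_trans (Nat.mul_le_mul_right _ (Nat.mul_le_mul_right _ (by norm_num))) (hnA24_of_ge h D g)

/-- **`hRn0`**: `R′0 ≤ n_L g (KS.fT mk fx)` (from `hnA`). [folklore] -/
theorem hRn0F_of_ge {fx : Neg.FSlot} (h : ∀ D : DataNS V, fxFc mk κ Φ t p D ≤ fx κ Φ t p D) (D : DataNS V) (g : ℕ) :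
    KS0.R'0 κ Φ t p D mk ≤ nL κ Φ t p D g (KS.fT mk fx κ Φ t p D) := by
  have h1 := hnAF_of_ge h D g
  have hKq := Neg.one_le_Kq κ
  have : KS0.R'0 κ Φ t p D mk ≤ 2000 * Neg.Kq κ * (KS0.R'0 κ Φ t p D mk + 2) := by nlinarith
  exact this.trans h1

/-- **The x-face reach budget** `πBudX ≤ ex` from any excess residual dominating `exFc` (the assemblies take `hr : πBudX ≤ r` with `ex ≤ r`). [folklore] -/
theorem hπX_of_ge {ex : GSlot} (h : ∀ (D : DataNS V) (g f : ℕ), exFc mk c κ Φ t p D g f ≤ ex κ Φ t p D g f) (D : DataNS V) (g f : ℕ) :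
    KS.πBudX κ Φ t p D c mk g f ≤ ex κ Φ t p D g f :=
  (exFc_floors κ Φ t p D g f mk c).1.trans (h D g f)

/-- **The y′-face reach budget** `πBudY ≤ ex` from any excess residual dominating `exFc`. [folklore] -/
theorem hπY_of_ge {ex : GSlot} (h : ∀ (D : DataNS V) (g f : ℕ), exFc mk c κ Φ t p D g f ≤ ex κ Φ t p D g f) (D : DataNS V) (g f : ℕ) :
    KS.πBudY κ Φ t p D c mk g f ≤ ex κ Φ t p D g f :=
  (exFc_floors κ Φ t p D g f mk c).2.trans (h D g f)

end Transfer

end NegB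

end PlanarSkeletonFrm

end Summit.CriticalPhenomena.PercolationContinuityZ3.Theorems.Transplant

end
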